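import Summits.CriticalPhenomena.PercolationContinuityZ3.Theorems.Transplant.FKConnectivityAllQAntipodalRootForm3General
import Summits.CriticalPhenomena.PercolationContinuityZ3.Theorems.Transplant.FKConnectivityAllQSPDualHost

/-!
# Connectivity correlation inequalities for `φ_{w,q}`, every `q > 0` — ROOT-FORM CALCULUS, file 74g: **`T2⁺` ON EVERY 2-CONNECTED
# SERIES–PARALLEL HOST** (the series-split hosts by planar two-terminal duality)

Support file (`--supports stmt-CriticalPhenomena-4575`), FK sub-lane `prim-bschramm-fk-2` (gen 32); builds on p205010 (kernel theorem,
internal audit signed; external expert review pending).  No definitions, no named facts, no sorries; standard axioms.  Memo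
FROM-fk-2-g31-DUALITY.md §0/§3/§6 (A), FROM-fk-2-g32-*.md; FK-Q2 §41.

File 74f proves the `q`-free `T2_x` inequality on every host `x ∥ 𝓔` whose first node separating `y, z, w` is PARALLEL.  By the orientation
clause of the subdivided two-terminal dual (file 71c `FK.IsTTSP.exists_dualHost`, (x)) the first separating node is parallel either in `𝓔` or in
its dual `𝓔''`; in the second case file 74f applies to the DUAL HOST `x'' ∥ 𝓔''` over the dual cell `(F'', C'')` with the increasing blind
weight `g''(B) = −g(C ∪ {e ∈ F : ẽ ∉ B})`, and the complement map `γ ↦ γ''` (an order-reversing bijection of the two configuration cubes,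
(vi)/(vii)) carries the level condition ((xi): `apExpC F'' C'' γ'' = apExpC F C γ + c`), the values of `T2` (pull-back identities (viii)/(ix):
`x̃ ∈ γ'' ∪ C'' ↔ x ∉ γ`, …) and the increments of `g` (`g''(γ'' ∪ C'') = −g(γ ∪ C)`, `g''((F'' \ γ'') ∪ C'') = −g((F \ γ) ∪ C)`) term by
term: the level-`J` `T2_x` sum of `x ∥ 𝓔` IS the level-`J''` `T2_{x''}` sum of the dual host.  Hence **`t2_levels_le_nonpos_of_isTTSP`**:
Conjecture `T2⁺` — `Z_H(z,q)² Cov_{φ_{z,q}}(T2_x, g) ∈ (q−1)·ℝ≥0[z,q]` coefficientwise, every cell — on EVERY 2-connected series–parallel graph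
`H = 𝓔 ∪ {x}`.
[cite: Grimmett2006, §1.4 eq. (1.20) (p. 15); §3.8 Thm. (3.90) (pp. 61–62); §3.9 (pp. 63–64); §6.1 eq. (6.3) (p. 133)]
[cite: Wagner2006, Thm. 5.8(d), §5.3]
-/

noncomputable section

namespace Summit.CriticalPhenomena.PercolationContinuityZ3.Theorems

namespace FK

namespace RootForm

open SimpleGraph Finset Literature.Probability.LatticeModels Literature.Probability.Percolation
open scoped Classical

variable {V : Type*} [Fintype V]

section Pull

variable {W : Type*} [DecidableEq W] {F C : Finset (Sym2 V)}

omit [Fintype V] in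
/-- the pull-back of `insert (τ s) A` along an injective `τ` is the pull-back of `A` minus `s`. [folklore] -/
theorem filter_notMem_insert_eq {τ : Sym2 V → Sym2 W} (hτ : Function.Injective τ) (F : Finset (Sym2 V)) (A : Finset (Sym2 W)) (s : Sym2 V) :
    F.filter (fun e => τ e ∉ insert (τ s) A) = (F.filter (fun e => τ e ∉ A)).erase s := by
  ext e
  simp only [Finset.mem_filter, Finset.mem_erase, Finset.mem_insert, not_or, hτ.eq_iff, ne_eq]
  tauto

omit [Fintype V] in
/-- **The pulled-back weight `B ↦ −g(C ∪ {e ∈ F : τ e ∉ B})` is blind to `τ s` if `g` is blind to `s`.** [folklore] -/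
theorem pullNeg_blind {τ : Sym2 V → Sym2 W} (hτ : Function.Injective τ) {g : Finset (Sym2 V) → ℝ} {s : Sym2 V}
    (hgs : ∀ A : Finset (Sym2 V), g (insert s A) = g A) (A : Finset (Sym2 W)) :
    -g (F.filter (fun e => τ e ∉ insert (τ s) A) ∪ C) = -g (F.filter (fun e => τ e ∉ A) ∪ C) := by
  rw [filter_notMem_insert_eq hτ, blind_erase_union hgs]

omit [Fintype V] in
/-- **The pulled-back weight is increasing if `g` is.** [folklore] -/
theorem pullNeg_mono (τ : Sym2 V → Sym2 W) {g : Finset (Sym2 V) → ℝ} (hmono : ∀ ⦃X Y : Finset (Sym2 V)⦄, X ⊆ Y → g X ≤ g Y)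
    ⦃A B : Finset (Sym2 W)⦄ (hAB : A ⊆ B) :
    -g (F.filter (fun e => τ e ∉ A) ∪ C) ≤ -g (F.filter (fun e => τ e ∉ B) ∪ C) := by
  have hsub : F.filter (fun e => τ e ∉ B) ⊆ F.filter (fun e => τ e ∉ A) := by
    intro e he
    rw [Finset.mem_filter] at he ⊢
    exact ⟨he.1, fun h => he.2 (hAB h)⟩
  linarith [hmono (Finset.union_subset_union hsub (le_refl C))]

end Pull

section Main

variable {E M C : Finset (Sym2 V)} {a b uy vy uz vz uw vw : V}

/-- `t2_levels_le_nonpos_of_isParSplit` (file 74f) with the `DecidableEq` instance of the statement as a parameter (the generic files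
elaborate their statements with the classical instance; at the concrete dual vertex type the structural instance is synthesized — this form
bridges the two, cf. file 71b). [folklore] -/
theorem t2_levels_le_nonpos_of_isParSplitD [DecidableEq V] (hE : IsParSplit E a b {s(uy, vy), s(uz, vz), s(uw, vw)}) (hx : s(a, b) ∉ E)
    (hy : s(uy, vy) ∈ E) (hz : s(uz, vz) ∈ E) (hw : s(uw, vw) ∈ E) (hyz : s(uy, vy) ≠ s(uz, vz)) (hyw : s(uy, vy) ≠ s(uw, vw)) (hzw : s(uz, vz) ≠ s(uw, vw))
    (hM : M ⊆ ((E.erase s(uy, vy)).erase s(uz, vz)).erase s(uw, vw)) (hC : C ⊆ ((E.erase s(uy, vy)).erase s(uz, vz)).erase s(uw, vw)) (hMC : Disjoint M C)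
    {g : Finset (Sym2 V) → ℝ} (hgx : ∀ A : Finset (Sym2 V), g (insert s(a, b) A) = g A)
    (hgy : ∀ A : Finset (Sym2 V), g (insert s(uy, vy) A) = g A) (hgz : ∀ A : Finset (Sym2 V), g (insert s(uz, vz) A) = g A)
    (hgw : ∀ A : Finset (Sym2 V), g (insert s(uw, vw) A) = g A)
    (hmono : ∀ ⦃X Y : Finset (Sym2 V)⦄, X ⊆ Y → g X ≤ g Y) (J : ℕ) :
    ∑ γ ∈ (insert s(a, b) (insert s(uy, vy) (insert s(uz, vz) (insert s(uw, vw) M)))).powerset with apExpC (insert s(a, b) (insert s(uy, vy) (insert s(uz, vz) (insert s(uw, vw) M)))) C γ ≤ J,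
        (((fun X : Finset (Sym2 _) => if (s(a, b) ∈ X ∧ (s(uy, vy) ∈ X ∨ s(uz, vz) ∈ X ∨ s(uw, vw) ∈ X)) ∨ (s(uy, vy) ∈ X ∧ s(uz, vz) ∈ X ∧ s(uw, vw) ∈ X) then (1 : ℝ) else 0) (γ ∪ C)) - ((fun X : Finset (Sym2 _) => if (s(a, b) ∈ X ∧ (s(uy, vy) ∈ X ∨ s(uz, vz) ∈ X ∨ s(uw, vw) ∈ X)) ∨ (s(uy, vy) ∈ X ∧ s(uz, vz) ∈ X ∧ s(uw, vw) ∈ X) then (1 : ℝ) else 0) ((insert s(a, b) (insert s(uy, vy) (insert s(uz, vz) (insert s(uw, vw) M)))) \ γ ∪ C))) *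
          (g (γ ∪ C) - g ((insert s(a, b) (insert s(uy, vy) (insert s(uz, vz) (insert s(uw, vw) M)))) \ γ ∪ C)) ≤ 0 := by
  convert t2_levels_le_nonpos_of_isParSplit (uy := uy) (vy := vy) (uz := uz) (vz := vz) (uw := uw) (vw := vw) (M := M) (C := C)
    (hE.of_inter_eq _ (by ext e; simp only [Finset.mem_inter, Finset.mem_insert, Finset.mem_singleton])) hx hy hz hw hyz hyw hzw
    (fun e he => by simpa only [Finset.mem_erase] using hM he) (fun e he => by simpa only [Finset.mem_erase] using hC he) hMC (g := g)
    (fun A => by convert hgx A) (fun A => by convert hgy A) (fun A => by convert hgz A)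
    (fun A => by convert hgw A) hmono J
  all_goals (dsimp only; congr 1; simp only [Finset.mem_union, Finset.mem_sdiff, Finset.mem_insert])

/-- **THEOREM (`T2⁺` on every 2-connected series–parallel host: the `q`-free `T2_x` inequality).**  Let `𝓔` be two-terminal
series–parallel between `a, b` and `x = ab ∉ 𝓔` (so `H = 𝓔 ∪ {x}` is an ARBITRARY 2-connected series–parallel graph presented from its edge `x`),
`y, z, w ∈ 𝓔` three further distinct special edges, `(M, C)` any cell inside `𝓔 \ {y,z,w}` (free / contracted, disjoint; `x, y, z, w` free).
Then for every increasing `g` blind to `x, y, z, w` and every level `J`: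
`Σ_{γ ⊆ M ∪ {x,y,z,w} : k(γ∪C)+k(γᶜ∪C) ≤ J} (T2_x(γ∪C) − T2_x(γᶜ∪C))·(g(γ∪C) − g(γᶜ∪C)) ≤ 0`, `T2_x = 1{(x ∧ (y ∨ z ∨ w)) ∨ (y ∧ z ∧ w)}`:
every coefficient — in the edge odds and in `q` — of `Z_H(z,q)² Cov_{φ_{z,q}}(T2_x, g)/(q − 1)` on this cell is nonnegative (Conjecture `T2⁺`,
the last open type of `C_∞⁺` at level 4).  Proof: orientation (file 71c) — parallel split: file 74f; series split: file 74f on the dual host,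
transported by the complement map.
[cite: Grimmett2006, §1.4 eq. (1.20) (p. 15); §3.8 Thm. (3.90) (pp. 61–62); §6.1 eq. (6.3) (p. 133)] [cite: Wagner2006, Thm. 5.8(d), §5.3] -/
theorem t2_levels_le_nonpos_of_isTTSP (hE : IsTTSP E a b) (hx : s(a, b) ∉ E)
    (hy : s(uy, vy) ∈ E) (hz : s(uz, vz) ∈ E) (hw : s(uw, vw) ∈ E) (hyz : s(uy, vy) ≠ s(uz, vz)) (hyw : s(uy, vy) ≠ s(uw, vw)) (hzw : s(uz, vz) ≠ s(uw, vw))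
    (hM : M ⊆ ((E.erase s(uy, vy)).erase s(uz, vz)).erase s(uw, vw)) (hC : C ⊆ ((E.erase s(uy, vy)).erase s(uz, vz)).erase s(uw, vw)) (hMC : Disjoint M C)
    {g : Finset (Sym2 V) → ℝ} (hgx : ∀ A : Finset (Sym2 V), g (insert s(a, b) A) = g A)
    (hgy : ∀ A : Finset (Sym2 V), g (insert s(uy, vy) A) = g A) (hgz : ∀ A : Finset (Sym2 V), g (insert s(uz, vz) A) = g A)
    (hgw : ∀ A : Finset (Sym2 V), g (insert s(uw, vw) A) = g A)
    (hmono : ∀ ⦃X Y : Finset (Sym2 V)⦄, X ⊆ Y → g X ≤ g Y) (J : ℕ) :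
    ∑ γ ∈ (insert s(a, b) (insert s(uy, vy) (insert s(uz, vz) (insert s(uw, vw) M)))).powerset with apExpC (insert s(a, b) (insert s(uy, vy) (insert s(uz, vz) (insert s(uw, vw) M)))) C γ ≤ J,
        (((fun X : Finset (Sym2 _) => if (s(a, b) ∈ X ∧ (s(uy, vy) ∈ X ∨ s(uz, vz) ∈ X ∨ s(uw, vw) ∈ X)) ∨ (s(uy, vy) ∈ X ∧ s(uz, vz) ∈ X ∧ s(uw, vw) ∈ X) then (1 : ℝ) else 0) (γ ∪ C)) - ((fun X : Finset (Sym2 _) => if (s(a, b) ∈ X ∧ (s(uy, vy) ∈ X ∨ s(uz, vz) ∈ X ∨ s(uw, vw) ∈ X)) ∨ (s(uy, vy) ∈ X ∧ s(uz, vz) ∈ X ∧ s(uw, vw) ∈ X) then (1 : ℝ) else 0) ((insert s(a, b) (insert s(uy, vy) (insert s(uz, vz) (insert s(uw, vw) M)))) \ γ ∪ C))) *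
          (g (γ ∪ C) - g ((insert s(a, b) (insert s(uy, vy) (insert s(uz, vz) (insert s(uw, vw) M)))) \ γ ∪ C)) ≤ 0 := by
  obtain ⟨hyM, hzM, hwM, hMe⟩ := cell₃_off hM
  obtain ⟨hyC, hzC, hwC, hCe⟩ := cell₃_off hC
  have hxy : s(a, b) ≠ s(uy, vy) := fun h => hx (h ▸ hy)
  have hxz : s(a, b) ≠ s(uz, vz) := fun h => hx (h ▸ hz)
  have hxw : s(a, b) ≠ s(uw, vw) := fun h => hx (h ▸ hw)
  have hxM : s(a, b) ∉ M := fun h => hx (hMe h)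
  have hxC : s(a, b) ∉ C := fun h => hx (hCe h)
  have hxM2 : s(a, b) ∉ insert s(uy, vy) (insert s(uz, vz) (insert s(uw, vw) M)) := by
    rw [Finset.mem_insert, not_or, Finset.mem_insert, not_or, Finset.mem_insert, not_or]; exact ⟨hxy, hxz, hxw, hxM⟩
  have hxF : s(a, b) ∈ (insert s(a, b) (insert s(uy, vy) (insert s(uz, vz) (insert s(uw, vw) M)))) := Finset.mem_insert_self _ _
  have hFH : (insert s(a, b) (insert s(uy, vy) (insert s(uz, vz) (insert s(uw, vw) M)))) ⊆ insert s(a, b) E :=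
    Finset.insert_subset_insert _ (Finset.insert_subset hy (Finset.insert_subset hz (Finset.insert_subset hw hMe)))
  have hFC : Disjoint (insert s(a, b) (insert s(uy, vy) (insert s(uz, vz) (insert s(uw, vw) M)))) C := by
    rw [Finset.disjoint_insert_left, Finset.disjoint_insert_left, Finset.disjoint_insert_left, Finset.disjoint_insert_left]
    exact ⟨hxC, hyC, hzC, hwC, hMC⟩
  have hSE : ({s(uy, vy), s(uz, vz), s(uw, vw)} : Finset (Sym2 V)) ∩ E = {s(uy, vy), s(uz, vz), s(uw, vw)} :=
    Finset.inter_eq_left.2 (Finset.insert_subset hy (Finset.insert_subset hz (Finset.singleton_subset_iff.2 hw)))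
  have hS2 : 2 ≤ (({s(uy, vy), s(uz, vz), s(uw, vw)} : Finset (Sym2 V)) ∩ E).card := by
    rw [hSE, Finset.card_insert_of_notMem (by rw [Finset.mem_insert, Finset.mem_singleton, not_or]; exact ⟨hyz, hyw⟩),
      Finset.card_pair hzw]; omega
  obtain ⟨φ, ψ, T, hx'', -, hC''E, hFC'', hγ'', hcard, pull₁, pull₂, O, c, -, thr⟩ := hE.exists_dualHost hx hxF hFH hCe hFC
  rcases O _ hS2 with hP | hP
  · exact t2_levels_le_nonpos_of_isParSplit hP hx hy hz hw hyz hyw hzw hM hC hMC hgx hgy hgz hgw hmono J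
  -- ### the series-split case: pass to the dual host
  have hinj := upper_injective φ
  rw [hSE, Finset.image_insert, Finset.image_insert, Finset.image_singleton] at hP
  obtain ⟨J'', hJ''⟩ := thr J
  -- the pull-back map `ẽ` and its injectivity
  have hne : ∀ e : Sym2 V, s((Sum.inl ∅ : Finset (Sym2 V) ⊕ Sym2 V), Sum.inl {s(a, b)}) ≠ s(Sum.inl (φ e), Sum.inr e) := by
    intro e h
    rcases Sym2.eq_iff.1 h with ⟨_, h2⟩ | ⟨h1, _⟩
    · exact Sum.inl_ne_inr h2
    · exact Sum.inl_ne_inr h1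
  have hτ : Function.Injective (fun e : Sym2 V => if e = s(a, b) then s((Sum.inl ∅ : Finset (Sym2 V) ⊕ Sym2 V), Sum.inl {s(a, b)}) else s(Sum.inl (φ e), Sum.inr e)) := by
    intro e e' h
    dsimp only at h
    by_cases he : e = s(a, b) <;> by_cases he' : e' = s(a, b)
    · rw [he, he']
    · rw [if_pos he, if_neg he'] at h; exact absurd h (hne e')
    · rw [if_neg he, if_pos he'] at h; exact absurd h.symm (hne e)
    · rw [if_neg he, if_neg he'] at h; exact hinj h
  have τx : (fun e : Sym2 V => if e = s(a, b) then s((Sum.inl ∅ : Finset (Sym2 V) ⊕ Sym2 V), Sum.inl {s(a, b)}) else s(Sum.inl (φ e), Sum.inr e)) s(a, b) = s((Sum.inl ∅ : Finset (Sym2 V) ⊕ Sym2 V), Sum.inl {s(a, b)}) := if_pos rfl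
  have τy : (fun e : Sym2 V => if e = s(a, b) then s((Sum.inl ∅ : Finset (Sym2 V) ⊕ Sym2 V), Sum.inl {s(a, b)}) else s(Sum.inl (φ e), Sum.inr e)) s(uy, vy) = s(Sum.inl (φ s(uy, vy)), Sum.inr s(uy, vy)) := if_neg hxy.symm
  have τz : (fun e : Sym2 V => if e = s(a, b) then s((Sum.inl ∅ : Finset (Sym2 V) ⊕ Sym2 V), Sum.inl {s(a, b)}) else s(Sum.inl (φ e), Sum.inr e)) s(uz, vz) = s(Sum.inl (φ s(uz, vz)), Sum.inr s(uz, vz)) := if_neg hxz.symm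
  have τw : (fun e : Sym2 V => if e = s(a, b) then s((Sum.inl ∅ : Finset (Sym2 V) ⊕ Sym2 V), Sum.inl {s(a, b)}) else s(Sum.inl (φ e), Sum.inr e)) s(uw, vw) = s(Sum.inl (φ s(uw, vw)), Sum.inr s(uw, vw)) := if_neg hxw.symm
  -- the dual cell: free set `F'' = x'' ∪ (F \ x)''`, its shape, the specials inside it
  have hFx : (insert s(a, b) (insert s(uy, vy) (insert s(uz, vz) (insert s(uw, vw) M)))).erase s(a, b) = insert s(uy, vy) (insert s(uz, vz) (insert s(uw, vw) M)) := Finset.erase_insert hxM2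
  have hF''eq : (insert s((Sum.inl ∅ : Finset (Sym2 V) ⊕ Sym2 V), Sum.inl {s(a, b)}) (((insert s(a, b) (insert s(uy, vy) (insert s(uz, vz) (insert s(uw, vw) M)))).erase s(a, b)).image (fun e : Sym2 V => s(Sum.inl (φ e), Sum.inr e)))) =
      insert s((Sum.inl ∅ : Finset (Sym2 V) ⊕ Sym2 V), Sum.inl {s(a, b)}) (insert (s(Sum.inl (φ s(uy, vy)), Sum.inr s(uy, vy))) (insert (s(Sum.inl (φ s(uz, vz)), Sum.inr s(uz, vz)))
        (insert (s(Sum.inl (φ s(uw, vw)), Sum.inr s(uw, vw))) (M.image (fun e : Sym2 V => s(Sum.inl (φ e), Sum.inr e)))))) := by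
    rw [hFx, Finset.image_insert, Finset.image_insert, Finset.image_insert]
  have upF : ∀ e ∈ insert s(uy, vy) (insert s(uz, vz) (insert s(uw, vw) M)), s(Sum.inl (φ e), Sum.inr e) ∈ (insert s((Sum.inl ∅ : Finset (Sym2 V) ⊕ Sym2 V), Sum.inl {s(a, b)}) (((insert s(a, b) (insert s(uy, vy) (insert s(uz, vz) (insert s(uw, vw) M)))).erase s(a, b)).image (fun e : Sym2 V => s(Sum.inl (φ e), Sum.inr e)))) := fun e he =>
    Finset.mem_insert_of_mem (Finset.mem_image_of_mem _ (by rw [hFx]; exact he))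
  have hyF' : s(uy, vy) ∈ insert s(uy, vy) (insert s(uz, vz) (insert s(uw, vw) M)) := Finset.mem_insert_self _ _
  have hzF' : s(uz, vz) ∈ insert s(uy, vy) (insert s(uz, vz) (insert s(uw, vw) M)) := Finset.mem_insert_of_mem (Finset.mem_insert_self _ _)
  have hwF' : s(uw, vw) ∈ insert s(uy, vy) (insert s(uz, vz) (insert s(uw, vw) M)) :=
    Finset.mem_insert_of_mem (Finset.mem_insert_of_mem (Finset.mem_insert_self _ _))
  have hMF' : M ⊆ insert s(uy, vy) (insert s(uz, vz) (insert s(uw, vw) M)) :=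
    ((Finset.subset_insert _ _).trans (Finset.subset_insert _ _)).trans (Finset.subset_insert _ _)
  have notC : ∀ e ∈ insert s(uy, vy) (insert s(uz, vz) (insert s(uw, vw) M)), s(Sum.inl (φ e), Sum.inr e) ∉ ((E \ ((insert s(a, b) (insert s(uy, vy) (insert s(uz, vz) (insert s(uw, vw) M)))) ∪ C)).image (fun e : Sym2 V => s(Sum.inl (φ e), Sum.inr e)) ∪ E.image (fun e : Sym2 V => s(Sum.inr e, Sum.inl (ψ e)))) :=
    fun e he => Finset.disjoint_left.1 hFC'' (upF e he)
  have upE : ∀ e ∈ E, s(Sum.inl (φ e), Sum.inr e) ∈ (E.image (fun e : Sym2 V => s(Sum.inl (φ e), Sum.inr e)) ∪ E.image (fun e : Sym2 V => s(Sum.inr e, Sum.inl (ψ e)))) := fun e he => Finset.mem_union_left _ (Finset.mem_image_of_mem _ he)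
  -- hypotheses of file 74f on the dual host
  have hM'' : M.image (fun e : Sym2 V => s(Sum.inl (φ e), Sum.inr e)) ⊆ (((E.image (fun e : Sym2 V => s(Sum.inl (φ e), Sum.inr e)) ∪ E.image (fun e : Sym2 V => s(Sum.inr e, Sum.inl (ψ e)))).erase (s(Sum.inl (φ s(uy, vy)), Sum.inr s(uy, vy)))).erase
      (s(Sum.inl (φ s(uz, vz)), Sum.inr s(uz, vz)))).erase (s(Sum.inl (φ s(uw, vw)), Sum.inr s(uw, vw))) := by
    intro e he
    obtain ⟨m, hm, rfl⟩ := Finset.mem_image.1 he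
    exact Finset.mem_erase.2 ⟨fun h => hwM (hinj h ▸ hm), Finset.mem_erase.2 ⟨fun h => hzM (hinj h ▸ hm),
      Finset.mem_erase.2 ⟨fun h => hyM (hinj h ▸ hm), upE m (hMe hm)⟩⟩⟩
  have hC'' : ((E \ ((insert s(a, b) (insert s(uy, vy) (insert s(uz, vz) (insert s(uw, vw) M)))) ∪ C)).image (fun e : Sym2 V => s(Sum.inl (φ e), Sum.inr e)) ∪ E.image (fun e : Sym2 V => s(Sum.inr e, Sum.inl (ψ e)))) ⊆ (((E.image (fun e : Sym2 V => s(Sum.inl (φ e), Sum.inr e)) ∪ E.image (fun e : Sym2 V => s(Sum.inr e, Sum.inl (ψ e)))).erase (s(Sum.inl (φ s(uy, vy)), Sum.inr s(uy, vy)))).erase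
      (s(Sum.inl (φ s(uz, vz)), Sum.inr s(uz, vz)))).erase (s(Sum.inl (φ s(uw, vw)), Sum.inr s(uw, vw))) := by
    intro e he
    exact Finset.mem_erase.2 ⟨fun h => notC _ hwF' (h ▸ he), Finset.mem_erase.2 ⟨fun h => notC _ hzF' (h ▸ he),
      Finset.mem_erase.2 ⟨fun h => notC _ hyF' (h ▸ he), hC''E he⟩⟩⟩
  have hMC'' : Disjoint (M.image (fun e : Sym2 V => s(Sum.inl (φ e), Sum.inr e))) ((E \ ((insert s(a, b) (insert s(uy, vy) (insert s(uz, vz) (insert s(uw, vw) M)))) ∪ C)).image (fun e : Sym2 V => s(Sum.inl (φ e), Sum.inr e)) ∪ E.image (fun e : Sym2 V => s(Sum.inr e, Sum.inl (ψ e)))) :=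
    Finset.disjoint_left.2 fun e he h => by
      obtain ⟨m, hm, rfl⟩ := Finset.mem_image.1 he
      exact notC m (hMF' hm) h
  -- the dual theorem
  have key := t2_levels_le_nonpos_of_isParSplitD hP hx'' (upE _ hy) (upE _ hz) (upE _ hw) (fun h => hyz (hinj h)) (fun h => hyw (hinj h))
    (fun h => hzw (hinj h)) hM'' hC'' hMC''
    (g := fun B => -g ((insert s(a, b) (insert s(uy, vy) (insert s(uz, vz) (insert s(uw, vw) M)))).filter (fun e => (if e = s(a, b) then s((Sum.inl ∅ : Finset (Sym2 V) ⊕ Sym2 V), Sum.inl {s(a, b)}) else s(Sum.inl (φ e), Sum.inr e)) ∉ B) ∪ C))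
    (fun A => by have h := pullNeg_blind (F := (insert s(a, b) (insert s(uy, vy) (insert s(uz, vz) (insert s(uw, vw) M))))) (C := C) hτ hgx A; rw [if_pos rfl] at h; exact h)
    (fun A => by have h := pullNeg_blind (F := (insert s(a, b) (insert s(uy, vy) (insert s(uz, vz) (insert s(uw, vw) M))))) (C := C) hτ hgy A; rw [if_neg (fun h' => hxy h'.symm)] at h; exact h)
    (fun A => by have h := pullNeg_blind (F := (insert s(a, b) (insert s(uy, vy) (insert s(uz, vz) (insert s(uw, vw) M))))) (C := C) hτ hgz A; rw [if_neg (fun h' => hxz h'.symm)] at h; exact h)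
    (fun A => by have h := pullNeg_blind (F := (insert s(a, b) (insert s(uy, vy) (insert s(uz, vz) (insert s(uw, vw) M))))) (C := C) hτ hgw A; rw [if_neg (fun h' => hxw h'.symm)] at h; exact h)
    (fun A B hAB => pullNeg_mono (F := (insert s(a, b) (insert s(uy, vy) (insert s(uz, vz) (insert s(uw, vw) M))))) (C := C) _ hmono hAB) J''
  rw [← hF''eq] at key
  -- ### term-by-term identification along the complement map `γ ↦ γ''`
  refine le_of_eq_of_le (Finset.sum_bij (fun γ _ => ((if s(a, b) ∈ γ then (∅ : Finset (Sym2 (Finset (Sym2 V) ⊕ Sym2 V))) else {s((Sum.inl ∅ : Finset (Sym2 V) ⊕ Sym2 V), Sum.inl {s(a, b)})}) ∪ (((insert s(a, b) (insert s(uy, vy) (insert s(uz, vz) (insert s(uw, vw) M)))).erase s(a, b)) \ γ).image (fun e : Sym2 V => s(Sum.inl (φ e), Sum.inr e)))) ?_ ?_ ?_ ?_) key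
  · -- into the dual level set
    intro γ hγ
    obtain ⟨hγF, hlev⟩ := Finset.mem_filter.1 hγ
    have hγF' := Finset.mem_powerset.1 hγF
    exact Finset.mem_filter.2 ⟨Finset.mem_powerset.2 (hγ'' γ hγF'), (hJ'' γ hγF').1 hlev⟩
  · -- injective
    intro γ₁ hγ₁ γ₂ hγ₂ h
    have h1 := pull₁ γ₁ (Finset.mem_powerset.1 (Finset.mem_filter.1 hγ₁).1)
    have h2 := pull₁ γ₂ (Finset.mem_powerset.1 (Finset.mem_filter.1 hγ₂).1)
    rw [← h1, ← h2, h]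
  · -- surjective (injective between cubes of the same size)
    intro δ hδ
    obtain ⟨hδF, hδlev⟩ := Finset.mem_filter.1 hδ
    have surj := Finset.surj_on_of_inj_on_of_card_le (s := (insert s(a, b) (insert s(uy, vy) (insert s(uz, vz) (insert s(uw, vw) M)))).powerset) (t := (insert s((Sum.inl ∅ : Finset (Sym2 V) ⊕ Sym2 V), Sum.inl {s(a, b)}) (((insert s(a, b) (insert s(uy, vy) (insert s(uz, vz) (insert s(uw, vw) M)))).erase s(a, b)).image (fun e : Sym2 V => s(Sum.inl (φ e), Sum.inr e)))).powerset)
      (fun γ _ => ((if s(a, b) ∈ γ then (∅ : Finset (Sym2 (Finset (Sym2 V) ⊕ Sym2 V))) else {s((Sum.inl ∅ : Finset (Sym2 V) ⊕ Sym2 V), Sum.inl {s(a, b)})}) ∪ (((insert s(a, b) (insert s(uy, vy) (insert s(uz, vz) (insert s(uw, vw) M)))).erase s(a, b)) \ γ).image (fun e : Sym2 V => s(Sum.inl (φ e), Sum.inr e)))) (fun γ hγ => Finset.mem_powerset.2 (hγ'' γ (Finset.mem_powerset.1 hγ)))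
      (fun γ₁ γ₂ hγ₁ hγ₂ h => by
        have h1 := pull₁ γ₁ (Finset.mem_powerset.1 hγ₁)
        have h2 := pull₁ γ₂ (Finset.mem_powerset.1 hγ₂)
        rw [← h1, ← h2, h])
      (by rw [Finset.card_powerset, Finset.card_powerset, hcard])
    obtain ⟨γ, hγ, hγδ⟩ := surj δ hδF
    have hγF := Finset.mem_powerset.1 hγ
    refine ⟨γ, Finset.mem_filter.2 ⟨hγ, (hJ'' γ hγF).2 (hγδ ▸ hδlev)⟩, hγδ.symm⟩
  · -- the summands agree
    intro γ hγ
    have hγF : γ ⊆ (insert s(a, b) (insert s(uy, vy) (insert s(uz, vz) (insert s(uw, vw) M)))) := Finset.mem_powerset.1 (Finset.mem_filter.1 hγ).1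
    have p1 : (insert s(a, b) (insert s(uy, vy) (insert s(uz, vz) (insert s(uw, vw) M)))).filter (fun e => (fun e : Sym2 V => if e = s(a, b) then s((Sum.inl ∅ : Finset (Sym2 V) ⊕ Sym2 V), Sum.inl {s(a, b)}) else s(Sum.inl (φ e), Sum.inr e)) e ∉ ((if s(a, b) ∈ γ then (∅ : Finset (Sym2 (Finset (Sym2 V) ⊕ Sym2 V))) else {s((Sum.inl ∅ : Finset (Sym2 V) ⊕ Sym2 V), Sum.inl {s(a, b)})}) ∪ (((insert s(a, b) (insert s(uy, vy) (insert s(uz, vz) (insert s(uw, vw) M)))).erase s(a, b)) \ γ).image (fun e : Sym2 V => s(Sum.inl (φ e), Sum.inr e))) ∪ ((E \ ((insert s(a, b) (insert s(uy, vy) (insert s(uz, vz) (insert s(uw, vw) M)))) ∪ C)).image (fun e : Sym2 V => s(Sum.inl (φ e), Sum.inr e)) ∪ E.image (fun e : Sym2 V => s(Sum.inr e, Sum.inl (ψ e))))) = γ := pull₁ γ hγF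
    have p2 : (insert s(a, b) (insert s(uy, vy) (insert s(uz, vz) (insert s(uw, vw) M)))).filter (fun e => (fun e : Sym2 V => if e = s(a, b) then s((Sum.inl ∅ : Finset (Sym2 V) ⊕ Sym2 V), Sum.inl {s(a, b)}) else s(Sum.inl (φ e), Sum.inr e)) e ∉ (insert s((Sum.inl ∅ : Finset (Sym2 V) ⊕ Sym2 V), Sum.inl {s(a, b)}) (((insert s(a, b) (insert s(uy, vy) (insert s(uz, vz) (insert s(uw, vw) M)))).erase s(a, b)).image (fun e : Sym2 V => s(Sum.inl (φ e), Sum.inr e)))) \ ((if s(a, b) ∈ γ then (∅ : Finset (Sym2 (Finset (Sym2 V) ⊕ Sym2 V))) else {s((Sum.inl ∅ : Finset (Sym2 V) ⊕ Sym2 V), Sum.inl {s(a, b)})}) ∪ (((insert s(a, b) (insert s(uy, vy) (insert s(uz, vz) (insert s(uw, vw) M)))).erase s(a, b)) \ γ).image (fun e : Sym2 V => s(Sum.inl (φ e), Sum.inr e))) ∪ ((E \ ((insert s(a, b) (insert s(uy, vy) (insert s(uz, vz) (insert s(uw, vw) M)))) ∪ C)).image (fun e : Sym2 V => s(Sum.inl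 (φ e), Sum.inr e)) ∪ E.image (fun e : Sym2 V => s(Sum.inr e, Sum.inl (ψ e))))) = (insert s(a, b) (insert s(uy, vy) (insert s(uz, vz) (insert s(uw, vw) M)))) \ γ := pull₂ γ hγF
    have m : ∀ s ∈ (insert s(a, b) (insert s(uy, vy) (insert s(uz, vz) (insert s(uw, vw) M)))), ((fun e : Sym2 V => if e = s(a, b) then s((Sum.inl ∅ : Finset (Sym2 V) ⊕ Sym2 V), Sum.inl {s(a, b)}) else s(Sum.inl (φ e), Sum.inr e)) s ∈ ((if s(a, b) ∈ γ then (∅ : Finset (Sym2 (Finset (Sym2 V) ⊕ Sym2 V))) else {s((Sum.inl ∅ : Finset (Sym2 V) ⊕ Sym2 V), Sum.inl {s(a, b)})}) ∪ (((insert s(a, b) (insert s(uy, vy) (insert s(uz, vz) (insert s(uw, vw) M)))).erase s(a, b)) \ γ).image (fun e : Sym2 V => s(Sum.inl (φ e), Sum.inr e))) ∪ ((E \ ((insert s(a, b) (insert s(uy, vy) (insert s(uz, vz) (insert s(uw, vw) M)))) ∪ C)).image (fun e : Sym2 V => s(Sum.inl (φ e), Sum.inr e)) ∪ E.image (fun e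 : Sym2 V => s(Sum.inr e, Sum.inl (ψ e)))) ↔ s ∉ γ) ∧ ((fun e : Sym2 V => if e = s(a, b) then s((Sum.inl ∅ : Finset (Sym2 V) ⊕ Sym2 V), Sum.inl {s(a, b)}) else s(Sum.inl (φ e), Sum.inr e)) s ∈ (insert s((Sum.inl ∅ : Finset (Sym2 V) ⊕ Sym2 V), Sum.inl {s(a, b)}) (((insert s(a, b) (insert s(uy, vy) (insert s(uz, vz) (insert s(uw, vw) M)))).erase s(a, b)).image (fun e : Sym2 V => s(Sum.inl (φ e), Sum.inr e)))) \ ((if s(a, b) ∈ γ then (∅ : Finset (Sym2 (Finset (Sym2 V) ⊕ Sym2 V))) else {s((Sum.inl ∅ : Finset (Sym2 V) ⊕ Sym2 V), Sum.inl {s(a, b)})}) ∪ (((insert s(a, b) (insert s(uy, vy) (insert s(uz, vz) (insert s(uw, vw) M)))).erase s(a, b)) \ γ).image (fun e : Sym2 V => s(Sum.inl (φ e), Sum.inr e))) ∪ ((E \ ((insert s(a, b) (insert s(uy, vy) (insert s(uz, vz) (insert s(uw, vw) M)))) ∪ C)).image (fun e : Sym2 V => s(Sum.inl (φ e), Sum.inr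 e)) ∪ E.image (fun e : Sym2 V => s(Sum.inr e, Sum.inl (ψ e)))) ↔ s ∈ γ) := by
      intro s hs
      have e1 := Finset.ext_iff.1 p1 s
      have e2 := Finset.ext_iff.1 p2 s
      rw [Finset.mem_filter] at e1 e2
      rw [Finset.mem_sdiff] at e2
      constructor
      · constructor
        · exact fun h hsγ => (e1.2 hsγ).2 h
        · intro hsγ; by_contra h; exact hsγ (e1.1 ⟨hs, h⟩)
      · constructor
        · intro h; by_contra hsγ; exact (e2.2 ⟨hs, hsγ⟩).2 h
        · intro hsγ; by_contra h; exact (e2.1 ⟨hs, h⟩).2 hsγ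
    obtain ⟨mx1, mx2⟩ := m _ hxF
    obtain ⟨my1, my2⟩ := m _ (Finset.mem_insert_of_mem hyF')
    obtain ⟨mz1, mz2⟩ := m _ (Finset.mem_insert_of_mem hzF')
    obtain ⟨mw1, mw2⟩ := m _ (Finset.mem_insert_of_mem hwF')
    rw [τx] at mx1 mx2
    rw [τy] at my1 my2
    rw [τz] at mz1 mz2
    rw [τw] at mw1 mw2
    have ox1 : s(a, b) ∈ γ ∪ C ↔ s(a, b) ∈ γ := by rw [Finset.mem_union, or_iff_left hxC]
    have oy1 : s(uy, vy) ∈ γ ∪ C ↔ s(uy, vy) ∈ γ := by rw [Finset.mem_union, or_iff_left hyC]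
    have oz1 : s(uz, vz) ∈ γ ∪ C ↔ s(uz, vz) ∈ γ := by rw [Finset.mem_union, or_iff_left hzC]
    have ow1 : s(uw, vw) ∈ γ ∪ C ↔ s(uw, vw) ∈ γ := by rw [Finset.mem_union, or_iff_left hwC]
    have ox2 : s(a, b) ∈ (insert s(a, b) (insert s(uy, vy) (insert s(uz, vz) (insert s(uw, vw) M)))) \ γ ∪ C ↔ s(a, b) ∉ γ := by
      rw [Finset.mem_union, or_iff_left hxC, Finset.mem_sdiff]; exact ⟨fun h => h.2, fun h => ⟨hxF, h⟩⟩
    have oy2 : s(uy, vy) ∈ (insert s(a, b) (insert s(uy, vy) (insert s(uz, vz) (insert s(uw, vw) M)))) \ γ ∪ C ↔ s(uy, vy) ∉ γ := by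
      rw [Finset.mem_union, or_iff_left hyC, Finset.mem_sdiff]; exact ⟨fun h => h.2, fun h => ⟨Finset.mem_insert_of_mem hyF', h⟩⟩
    have oz2 : s(uz, vz) ∈ (insert s(a, b) (insert s(uy, vy) (insert s(uz, vz) (insert s(uw, vw) M)))) \ γ ∪ C ↔ s(uz, vz) ∉ γ := by
      rw [Finset.mem_union, or_iff_left hzC, Finset.mem_sdiff]; exact ⟨fun h => h.2, fun h => ⟨Finset.mem_insert_of_mem hzF', h⟩⟩
    have ow2 : s(uw, vw) ∈ (insert s(a, b) (insert s(uy, vy) (insert s(uz, vz) (insert s(uw, vw) M)))) \ γ ∪ C ↔ s(uw, vw) ∉ γ := by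
      rw [Finset.mem_union, or_iff_left hwC, Finset.mem_sdiff]; exact ⟨fun h => h.2, fun h => ⟨Finset.mem_insert_of_mem hwF', h⟩⟩
    simp only [p1, p2, mx1, mx2, my1, my2, mz1, mz2, mw1, mw2, ox1, oy1, oz1, ow1, ox2, oy2, oz2, ow2]
    ring

end Main

end RootForm

end FK

end Summit.CriticalPhenomena.PercolationContinuityZ3.Theorems

end
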